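import Literature.AlgebraicGeometry.Resolution.MonomialOrderReduction
import Literature.AlgebraicGeometry.Resolution.MarkedIdealsRestrict
import Literature.AlgebraicGeometry.Resolution.KollarMaxContactPersistence
import HarnessLib

/-!
# [OURS · L1 W4.6 rung (ii-M⁺)] THE MONOMIAL SLICE OF THE HOST ITEM ITSELF — stmt-16156's literal conclusion
# (`IsMarkedResolution ⟨I, E, m⟩`, boundary bookkeeping INCLUDED) for every SNC-monomial input, in EVERY dimension, PROVED

Cell res-hironaka, LADDER-RESOLUTION rung L (D-0089), slot W4.6 «restricted-regime rungs of the typed Th. 16.6 procedure»,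
rung (ii) (threefold hypersurfaces); seat res-L1-s46-pv-3 (gen 3). Host route MarkedTransfer, host item
`HypersurfaceOrderReductionDimLeThree` (stmt-ResolutionOfSingularities-16156: for every perfect field `k` of characteristic
`p`, every separated / locally-of-finite-type / quasi-compact / integral / regular `k`-scheme `X` of dimension `≤ 3`, every
effective Cartier `I ≠ 0`, every simple-normal-crossings boundary `E` and every `m ≥ 1`, a BGMW marked resolution
`∃ X′ Φ M′, IsMarkedResolution ⟨I, E, m⟩ Φ M′`); filed `--kind proof --supports` it `--as helper`. This file does NOT import
the route file (the host's binders are copied verbatim where used, so the slice stays importable outside the Theses cone).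
Everything here is OURS: kernel theorems over PROVED tree lemmas; NOTHING is a statement of Hironaka's manuscript; no typed
`Hironaka2017` candidate enters; no `Literature.…` named FACT is used as a hypothesis. AI-written; AI review is weaker than
expert review.

## What is proved (no new definitions)

* `CampaignW46.exists_isMarkedResolution_monomial_of_sublist` — **THE MONOMIAL SLICE OF THE HOST ITEM, every dimension**:
  on a locally Noetherian scheme `X`, let `Ea = [(𝓘_{E_1}, a_1), …, (𝓘_{E_r}, a_r)]` be an exponent list whose boundary
  `E⁺ := (𝓘_{E_j})_j` has simple normal crossings, let `E` be any SUB-boundary of `E⁺` (a sublist: the host's boundary may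
  omit some of the divisors the monomial uses) and `m ≥ 1`. Then the marked ideal `(X, Π_j 𝓘_{E_j}^{a_j}, E, m)` admits a
  BGMW marked resolution: `∃ X′ Φ M′, IsMarkedResolution ⟨monomialIdeal Ea, E, m⟩ Φ M′` — regular centres inside the
  successive supports, having simple normal crossings with the successive transformed boundaries, final support empty.
  Proof: Kollár (3.111) Step 3 as PROVED in the tree for the full boundary `E⁺` (`exists_isResolutionOf_monomialMarked`),
  then FORGET the extra boundary divisors (`CentreSeq.IsResolutionOf.of_boundary_sublist`, BGMW §4 Step 1a).
* `…_monomial` (the case `E = E⁺`: `I` a monomial in the host's own boundary) and `…_monomial_nil` (the case `E = []`).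
* `CampaignW46.exists_isMarkedResolution_of_forall_idealOrder_lt` — the trivial LOW-ORDER slice: if `ord_x I < m`
  everywhere, the empty sequence resolves `(X, I, E, m)` for every boundary `E`.
* `CampaignW46.exists_isMarkedResolution_pow_of_hasSNC_singleton[_nil]` / `…_pow_of_generator_nil` — the DIVISORIAL slice:
  `(X, 𝓘_S^a, [𝓘_S], m)` and `(X, 𝓘_S^a, [], m)` for a single simple-normal-crossings divisor `S` (on a regular locally
  Noetherian `X`: an ideal generated at each point of its support by an element of order one — a regular hypersurface).
* `CampaignW46.hostItem_monomial_slice` — **stmt-16156's binders VERBATIM (universe-polymorphic) plus ONE hypothesis**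
  (`∃ Ea, HasSNC (boundaryOf Ea) ∧ E.Sublist (boundaryOf Ea) ∧ I = monomialIdeal Ea`) **⇒ stmt-16156's conclusion
  VERBATIM** `∃ X′ Φ M′, IsMarkedResolution ⟨I, E, m⟩ Φ M′`. Only local Noetherianity (from local finite type over the
  field) is used; the slice is dimension-free and characteristic-free.

HONEST VALUE. A PARTIAL RESULT ON THE HOST ITEM'S LITERAL CONCLUSION (boundary included), not on a Γ-free shadow: the
calibration item stmt-16156 («known case», expected to close modulo a cite fact for Cossart–Jannsen–Saito) HOLDS
UNCONDITIONALLY on the slice of inputs `(X, I, E, m)` whose hypersurface ideal is a monomial in some simple-normal-crossings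
boundary containing `E` — at every dimension, so in particular for the threefold item. This is the COMBINATORIAL («Γ») part
of any boundary-carrying order reduction; the mathematics is the tree's (Kollár Step 3 + BGMW Step 1a, kernel-checked
there); this file is the bridge in the host's words. It says nothing about non-monomial inputs (embedded curves/surfaces),
where stmt-16156's content lives, nor about the typed procedure or the manuscript.

References: tree `Resolution/MonomialOrderReduction.lean` (`exists_isResolutionOf_monomialMarked` [Kollar2007, (3.111)
Step 3] [BierstoneGrigorievMilmanWlodarczyk2011, §4 Step 2b]), `Resolution/MarkedIdealsRestrict.lean`
(`CentreSeq.IsResolutionOf.of_boundary_sublist` [BierstoneGrigorievMilmanWlodarczyk2011, §4 Step 1a]),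
`Resolution/BlowupSequences.lean` (`CentreSeq.IsResolutionOf.isMarkedResolution`), `Resolution/MonomialMarkedIdeals.lean`
(`monomialIdeal`, `boundaryOf`, `monomialMarked`), `Resolution/KollarMaxContactPersistence.lean`
(`hasSNC_singleton_of_generator` [Matsumura1987, Thm. 14.2]), `Resolution/MarkedIdeals.lean` (`HasSNC`, `IsMultipleBlowup`,
`IsMarkedResolution` [BierstoneGrigorievMilmanWlodarczyk2011, Def. 3.1.3]); route file `Theses/MarkedTransfer.lean`
(stmt-16156) — NOT imported; companions `…ThreefoldsGammaFreeGlobalMonomial.lean` (p499147, the Γ-free shadow of this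
slice). H. Hironaka, ms. 2017-03-23 — scope only, under adjudication, not cited as fact. [Hironaka2017]
-/

noncomputable section

set_option linter.dupNamespace false -- mandated namespace of this single-conjunct summit

open CategoryTheory AlgebraicGeometry TopologicalSpace IsLocalRing

namespace Summit.ResolutionOfSingularities.ResolutionOfSingularities.Theorems

namespace CampaignW46

open Literature.AlgebraicGeometry.Resolution
open Scheme.IdealSheafData

universe u

variable {X : Scheme.{u}}

/-! ## §1 The monomial slice of the host item's conclusion -/

/-- **THE MONOMIAL SLICE OF stmt-16156's CONCLUSION, EVERY DIMENSION.** On a locally Noetherian scheme `X`, let `Ea` be an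
exponent list whose boundary `boundaryOf Ea` has simple normal crossings (this includes: `X` regular), let `E` be a
sublist of `boundaryOf Ea`, and `m ≥ 1`. Then the marked ideal `(X, Π_j 𝓘_{E_j}^{a_j}, E, m)` has a BGMW marked resolution:
`∃ X′ (Φ : X′ ⟶ X) M′, IsMarkedResolution ⟨monomialIdeal Ea, E, m⟩ Φ M′`. (Kollár's Step-3 sequence for the full boundary,
tree `exists_isResolutionOf_monomialMarked`; forgetting boundary divisors keeps a resolution a resolution, tree
`CentreSeq.IsResolutionOf.of_boundary_sublist`.) [cite: Kollar2007, (3.111) Step 3] -/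
theorem exists_isMarkedResolution_monomial_of_sublist [IsLocallyNoetherian X] (Ea : List (X.IdealSheafData × ℕ))
    (hEa : HasSNC (boundaryOf Ea)) {E : List X.IdealSheafData} (hE : E.Sublist (boundaryOf Ea)) {m : ℕ} (hm : 1 ≤ m) :
    ∃ (X' : Scheme.{u}) (Φ : X' ⟶ X) (M' : MarkedIdeal X'),
      IsMarkedResolution (⟨monomialIdeal Ea, E, m⟩ : MarkedIdeal X) Φ M' := by
  obtain ⟨s, hs⟩ := exists_isResolutionOf_monomialMarked Ea hEa hm
  have hs' : s.IsResolutionOf (⟨monomialIdeal Ea, boundaryOf Ea, m⟩ : MarkedIdeal X) := hs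
  exact ⟨_, s.comp, _, (CentreSeq.IsResolutionOf.of_boundary_sublist s hE hs').isMarkedResolution⟩

/-- The case `E = boundaryOf Ea`: **`I` a monomial in the host's own simple-normal-crossings boundary** — the marked ideal
`(X, Π_j 𝓘_{E_j}^{a_j}, (𝓘_{E_j})_j, m)` has a BGMW marked resolution (this is the tree's Kollár Step 3 verbatim, in the
`∃ X′ Φ M′` shape of stmt-16156's conclusion). [cite: Kollar2007, (3.111) Step 3] -/
theorem exists_isMarkedResolution_monomial [IsLocallyNoetherian X] (Ea : List (X.IdealSheafData × ℕ))
    (hEa : HasSNC (boundaryOf Ea)) {m : ℕ} (hm : 1 ≤ m) :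
    ∃ (X' : Scheme.{u}) (Φ : X' ⟶ X) (M' : MarkedIdeal X'),
      IsMarkedResolution (⟨monomialIdeal Ea, boundaryOf Ea, m⟩ : MarkedIdeal X) Φ M' :=
  exists_isMarkedResolution_monomial_of_sublist Ea hEa (List.Sublist.refl _) hm

/-- The case `E = []`: **an SNC-monomial hypersurface ideal with EMPTY boundary** has a BGMW marked resolution
`(X, Π_j 𝓘_{E_j}^{a_j}, ∅, m)`, `m ≥ 1`. [cite: BierstoneGrigorievMilmanWlodarczyk2011, §4 Step 1a] -/
theorem exists_isMarkedResolution_monomial_nil [IsLocallyNoetherian X] (Ea : List (X.IdealSheafData × ℕ))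
    (hEa : HasSNC (boundaryOf Ea)) {m : ℕ} (hm : 1 ≤ m) :
    ∃ (X' : Scheme.{u}) (Φ : X' ⟶ X) (M' : MarkedIdeal X'),
      IsMarkedResolution (⟨monomialIdeal Ea, [], m⟩ : MarkedIdeal X) Φ M' :=
  exists_isMarkedResolution_monomial_of_sublist Ea hEa (List.nil_sublist _) hm

/-! ## §2 The low-order slice and the divisorial slice -/

/-- **THE LOW-ORDER SLICE** (pure logic): if `ord_x I < m` at every point, the marked ideal `(X, I, E, m)` has empty
support and the EMPTY sequence is a marked resolution, for every boundary `E`. [cite: BierstoneGrigorievMilmanWlodarczyk2011, Def. 3.1.3] -/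
theorem exists_isMarkedResolution_of_forall_idealOrder_lt (I : X.IdealSheafData) (E : List X.IdealSheafData) {m : ℕ}
    (h : ∀ x : X, idealOrder I x < m) :
    ∃ (X' : Scheme.{u}) (Φ : X' ⟶ X) (M' : MarkedIdeal X'), IsMarkedResolution (⟨I, E, m⟩ : MarkedIdeal X) Φ M' := by
  refine ⟨X, 𝟙 X, ⟨I, E, m⟩, IsMultipleBlowup.refl _, ?_⟩
  ext x
  simp only [MarkedIdeal.support, Set.mem_setOf_eq, Set.mem_empty_iff_false, iff_false, not_le]
  exact h x

/-- **THE DIVISORIAL SLICE, boundary `[𝓘_S]`**: for a single simple-normal-crossings divisor `S` (`HasSNC [H]`, `H = 𝓘_S`),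
the marked ideal `(X, H^a, [H], m)` has a BGMW marked resolution, `m ≥ 1` (blow up `S` itself — an admissible Cartier centre,
identity blow-ups — until the exponent drops below `m`). [cite: Kollar2007, (3.111) Step 3] -/
theorem exists_isMarkedResolution_pow_of_hasSNC_singleton [IsLocallyNoetherian X] {H : X.IdealSheafData}
    (hH : HasSNC [H]) (a : ℕ) {m : ℕ} (hm : 1 ≤ m) :
    ∃ (X' : Scheme.{u}) (Φ : X' ⟶ X) (M' : MarkedIdeal X'), IsMarkedResolution (⟨H ^ a, [H], m⟩ : MarkedIdeal X) Φ M' := by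
  have h := exists_isMarkedResolution_monomial [(H, a)] hH hm
  rwa [monomialIdeal_singleton] at h

/-- **THE DIVISORIAL SLICE, empty boundary**: `(X, 𝓘_S^a, ∅, m)` has a BGMW marked resolution for a single
simple-normal-crossings divisor `S`, `m ≥ 1`. [cite: Kollar2007, (3.111) Step 3] -/
theorem exists_isMarkedResolution_pow_of_hasSNC_singleton_nil [IsLocallyNoetherian X] {H : X.IdealSheafData}
    (hH : HasSNC [H]) (a : ℕ) {m : ℕ} (hm : 1 ≤ m) :
    ∃ (X' : Scheme.{u}) (Φ : X' ⟶ X) (M' : MarkedIdeal X'), IsMarkedResolution (⟨H ^ a, [], m⟩ : MarkedIdeal X) Φ M' := by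
  have h := exists_isMarkedResolution_monomial_nil [(H, a)] hH hm
  rwa [monomialIdeal_singleton] at h

/-- **THE DIVISORIAL SLICE, regular-hypersurface form, empty boundary**: on a regular locally Noetherian scheme `X`, if the
ideal sheaf `H` is generated at each point of its support by ONE element of order one (`H_x = (v)`, `v ∉ 𝔪_x²`: `V(H)` a
regular hypersurface), then `(X, H^a, ∅, m)` has a BGMW marked resolution for all `a` and all `m ≥ 1`.
[cite: Matsumura1987, Thm. 14.2] -/
theorem exists_isMarkedResolution_pow_of_generator_nil [IsLocallyNoetherian X] (hX : Scheme.IsRegular X)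
    {H : X.IdealSheafData} (hH : ∀ x ∈ H.support, ∃ v : X.presheaf.stalk x,
      stalkIdeal H x = Ideal.span {v} ∧ v ∉ (maximalIdeal (X.presheaf.stalk x)) ^ 2)
    (a : ℕ) {m : ℕ} (hm : 1 ≤ m) :
    ∃ (X' : Scheme.{u}) (Φ : X' ⟶ X) (M' : MarkedIdeal X'), IsMarkedResolution (⟨H ^ a, [], m⟩ : MarkedIdeal X) Φ M' :=
  exists_isMarkedResolution_pow_of_hasSNC_singleton_nil (hasSNC_singleton_of_generator hX hH) a hm

/-! ## §3 In the host item's binders -/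

/-- **THE MONOMIAL SLICE OF THE HOST ITEM stmt-16156, binders VERBATIM** (universe-polymorphic; the item is its
universe-`0` instance) **plus ONE hypothesis** — `I` is a monomial in some simple-normal-crossings boundary of which the
given `E` is a sublist: for every prime `p`, every perfect field `k` of characteristic `p`, every separated,
locally-of-finite-type, quasi-compact, integral, regular `k`-scheme `X` with `topologicalKrullDim X ≤ 3`, every effective
Cartier `I ≠ 0`, every `E` with `HasSNC E`, provided `∃ Ea, HasSNC (boundaryOf Ea) ∧ E.Sublist (boundaryOf Ea) ∧
I = monomialIdeal Ea`, and every `m ≥ 1`: `∃ X′ Φ M′, IsMarkedResolution ⟨I, E, m⟩ Φ M′` — the CONCLUSION OF stmt-16156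
VERBATIM. Only local Noetherianity (from local finite type over a field) and the monomiality are used: the slice is in
fact dimension-free (the bound `≤ 3` is carried, not used) and characteristic-free. [cite: Kollar2007, (3.111) Step 3] -/
theorem hostItem_monomial_slice :
    ∀ p : ℕ, p.Prime → ∀ (k : Type u) [Field k] [CharP k p] [PerfectField k] (X : Scheme.{u}) (s : X ⟶ Spec (.of k)),
      IsSeparated s → LocallyOfFiniteType s → QuasiCompact s → IsIntegral X → Scheme.IsRegular X →
        topologicalKrullDim X ≤ 3 → ∀ (I : X.IdealSheafData), I ≠ ⊥ → IsEffectiveCartier I →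
          ∀ (E : List X.IdealSheafData), HasSNC E →
            (∃ Ea : List (X.IdealSheafData × ℕ), HasSNC (boundaryOf Ea) ∧ E.Sublist (boundaryOf Ea) ∧ I = monomialIdeal Ea) →
              ∀ (m : ℕ), 1 ≤ m → ∃ (X' : Scheme.{u}) (Φ : X' ⟶ X) (M' : MarkedIdeal X'),
                IsMarkedResolution (⟨I, E, m⟩ : MarkedIdeal X) Φ M' := by
  intro _ _ k _ _ _ X s _ hloft _ _ _ _ I _ _ E _ hI m hm
  haveI : IsLocallyNoetherian X := LocallyOfFiniteType.isLocallyNoetherian s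
  obtain ⟨Ea, hEa, hE, rfl⟩ := hI
  exact exists_isMarkedResolution_monomial_of_sublist Ea hEa hE hm

/-- The same with the dimension bound replaced by ANY `d` (the host-side analogue of the ladder
`GammaFreeGlobalOrderReductionDimLE p d`): the monomial slice of «hypersurface order reduction with boundary in dimension
`≤ d`» holds for every `d`. [cite: Kollar2007, (3.111) Step 3] -/
theorem hostItem_monomial_slice_dimLE (d : ℕ) :
    ∀ p : ℕ, p.Prime → ∀ (k : Type u) [Field k] [CharP k p] [PerfectField k] (X : Scheme.{u}) (s : X ⟶ Spec (.of k)),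
      IsSeparated s → LocallyOfFiniteType s → QuasiCompact s → IsIntegral X → Scheme.IsRegular X →
        topologicalKrullDim X ≤ d → ∀ (I : X.IdealSheafData), I ≠ ⊥ → IsEffectiveCartier I →
          ∀ (E : List X.IdealSheafData), HasSNC E →
            (∃ Ea : List (X.IdealSheafData × ℕ), HasSNC (boundaryOf Ea) ∧ E.Sublist (boundaryOf Ea) ∧ I = monomialIdeal Ea) →
              ∀ (m : ℕ), 1 ≤ m → ∃ (X' : Scheme.{u}) (Φ : X' ⟶ X) (M' : MarkedIdeal X'),
                IsMarkedResolution (⟨I, E, m⟩ : MarkedIdeal X) Φ M' := by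
  intro _ _ k _ _ _ X s _ hloft _ _ _ _ I _ _ E _ hI m hm
  haveI : IsLocallyNoetherian X := LocallyOfFiniteType.isLocallyNoetherian s
  obtain ⟨Ea, hEa, hE, rfl⟩ := hI
  exact exists_isMarkedResolution_monomial_of_sublist Ea hEa hE hm

end CampaignW46

end Summit.ResolutionOfSingularities.ResolutionOfSingularities.Theorems

end
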